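import Mathlib
import HarnessLib
import Summits.AtomisticToContinuum.FouriersLaw.Theorems.VanishingNoiseTransferNoisyFourierAbelPairingDefect
import Summits.AtomisticToContinuum.FouriersLaw.Theorems.VanishingNoiseTransferNoisyFourierThomsonWitnessBlocks
import Summits.AtomisticToContinuum.FouriersLaw.Theorems.VanishingNoiseTransferNoisyFourierThomsonWitnessPattern
import Summits.AtomisticToContinuum.FouriersLaw.Theorems.VanishingNoiseTransferNoisyFourierThomsonWitnessMomentsAux1

/-!
# The current pairing of the Thomson witness: `∫ v J dμ_T = (L − 1) T²`
(line `abel-storage-decay`, crux `VanishingNoiseTransfer.NoisyFourier`, stmt-AtomisticToContinuum-11977, stubs B / A7; lead c7)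

`--supports stmt-AtomisticToContinuum-11977` file. Setting: the pinned anharmonic chain `𝐏 = pinnedChain ω₂ lam β γ`
(parameters `> 0`), `T > 0`, `L ≥ 2`, Gibbs measure `μ_T = 𝐏.gibbsMeasure L T`, total current `J = Σ_i j_i`, and the lead's
THOMSON WITNESS (explicit, local, charge one)

  `v = Σ_{bonds (i, j = i+1)} [ p_i (p_j² φ'(r) − ∂_{q_j}H φ(r)) + p_j (p_i² φ'(r) + ∂_{q_i}H φ(r)) ]`,
  `r = q_j − q_i`, `φ = 1/V'' = 1/(1 + 3βr²)`  (`v = Σ_k (X_{k+1} − X_k)(p_k p_{k+1}/V''(r_k))`, `X_k` the single-site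
  Liouville fields).

* `integral_thomsonWitness_mul_totalCurrent` — for `L ≥ 2`, granted `v, Xv, L_{T,T}v ∈ L²(μ_T)` (the cost files of the
  witness project), `∫ v · J dμ_T = (L − 1) T²`: the landed pairing-defect identity `∫ w J = ∫ (Σ_{i+1<L} E_{≤i}) · P₀(Xw)`
  (`AbelThomson.integral_mul_totalCurrent_eq_pattern`, p155531), the pointwise PATTERN IDENTITY `P₀(Xv) = p_0² − p_{L−1}²`
  (`ThomsonWitness.Algebra.patternAvg_liouvillian_thomsonWitness`: the pattern defect of `v` is a pure bath term), and the
  Gaussian value `∫ (Σ_{i+1<L} E_{≤i})(p_0² − p_{L−1}²) dμ_T = (L − 1)T²`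
  (`ThomsonWitness.Moments.integral_blockEnergySum_mul_sq_sub_sq`).
* `helper_thomsonWitnessPairing` — registered notation-free restatement.

This is the extensive half of the Thomson lower bound `⟨J,v⟩² ≤ 2σ_L(s)Q_s(v)`: together with the `O(L)` costs of `v` and
its CONSTANT pattern-defect norm `‖P₀Xv‖² = 4T²` it gives the bulk Abel–Green–Kubo floor for flips alone (stub B via
`bulkPositivity_of_witnessFamily`, and the `s`-uniform floor A7 via `abelThomsonBath_sq`). References: Bernardin–Olla 2011
§6 (variational formulas; §6.2: no lower bound for flips alone was available); folklore. No definitions; standard axioms.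
-/

noncomputable section

open MeasureTheory Filter Topology
open scoped BigOperators
open Literature.MathematicalPhysics.KineticTheory.HeatConduction
open Summit.AtomisticToContinuum.FouriersLaw.Theorems.NoisyFourier.AbelThomson (integral_mul_totalCurrent_eq_pattern)
open Summit.AtomisticToContinuum.FouriersLaw.Theorems.NoisyFourier.ThomsonWitness.Algebra
  (contDiff_two_thomsonWitness patternAvg_liouvillian_thomsonWitness)
open Summit.AtomisticToContinuum.FouriersLaw.Theorems.NoisyFourier.ThomsonWitness.Moments
  (integral_blockEnergySum_mul_sq_sub_sq)

namespace Summit.AtomisticToContinuum.FouriersLaw.Theorems.NoisyFourier.ThomsonWitness.Pairing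

variable {ω₂ lam β γ : ℝ}

/-- **The current pairing of the Thomson witness.** For the pinned chain (parameters `> 0`), `T > 0`, `L ≥ 2`, and the
witness `v` with `v, Xv, L_{T,T}v ∈ L²(μ_T)`: `∫ v · J dμ_T = (L − 1) T²`. [folklore] -/
theorem integral_thomsonWitness_mul_totalCurrent (hω : 0 < ω₂) (hl : 0 < lam) (hβ : 0 < β) (hγ : 0 < γ) {T : ℝ}
    (hT : 0 < T) {L : ℕ} (hL : 2 ≤ L)
    (hv2 : MemLp (fun x : PhaseSpace L => ∑ i : Fin L, ∑ j : Fin L, if j.val = i.val + 1 then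
        (x.2 i * (x.2 j ^ 2 * (-(6 * β * (x.1 j - x.1 i)) / (1 + 3 * β * (x.1 j - x.1 i) ^ 2) ^ 2) -
            partialQ j ((pinnedChain ω₂ lam β γ).hamiltonian L) x * (1 / (1 + 3 * β * (x.1 j - x.1 i) ^ 2))) +
          x.2 j * (x.2 i ^ 2 * (-(6 * β * (x.1 j - x.1 i)) / (1 + 3 * β * (x.1 j - x.1 i) ^ 2) ^ 2) +
            partialQ i ((pinnedChain ω₂ lam β γ).hamiltonian L) x * (1 / (1 + 3 * β * (x.1 j - x.1 i) ^ 2))))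
        else 0) 2 ((pinnedChain ω₂ lam β γ).gibbsMeasure L T))
    (hXv2 : MemLp ((pinnedChain ω₂ lam β γ).liouvillian L (fun x : PhaseSpace L => ∑ i : Fin L, ∑ j : Fin L,
        if j.val = i.val + 1 then
        (x.2 i * (x.2 j ^ 2 * (-(6 * β * (x.1 j - x.1 i)) / (1 + 3 * β * (x.1 j - x.1 i) ^ 2) ^ 2) -
            partialQ j ((pinnedChain ω₂ lam β γ).hamiltonian L) x * (1 / (1 + 3 * β * (x.1 j - x.1 i) ^ 2))) +
          x.2 j * (x.2 i ^ 2 * (-(6 * β * (x.1 j - x.1 i)) / (1 + 3 * β * (x.1 j - x.1 i) ^ 2) ^ 2) +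
            partialQ i ((pinnedChain ω₂ lam β γ).hamiltonian L) x * (1 / (1 + 3 * β * (x.1 j - x.1 i) ^ 2))))
        else 0)) 2 ((pinnedChain ω₂ lam β γ).gibbsMeasure L T))
    (hGv2 : MemLp ((pinnedChain ω₂ lam β γ).generator L T T (fun x : PhaseSpace L => ∑ i : Fin L, ∑ j : Fin L,
        if j.val = i.val + 1 then
        (x.2 i * (x.2 j ^ 2 * (-(6 * β * (x.1 j - x.1 i)) / (1 + 3 * β * (x.1 j - x.1 i) ^ 2) ^ 2) -
            partialQ j ((pinnedChain ω₂ lam β γ).hamiltonian L) x * (1 / (1 + 3 * β * (x.1 j - x.1 i) ^ 2))) +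
          x.2 j * (x.2 i ^ 2 * (-(6 * β * (x.1 j - x.1 i)) / (1 + 3 * β * (x.1 j - x.1 i) ^ 2) ^ 2) +
            partialQ i ((pinnedChain ω₂ lam β γ).hamiltonian L) x * (1 / (1 + 3 * β * (x.1 j - x.1 i) ^ 2))))
        else 0)) 2 ((pinnedChain ω₂ lam β γ).gibbsMeasure L T)) :
    ∫ x, (∑ i : Fin L, ∑ j : Fin L, if j.val = i.val + 1 then
        (x.2 i * (x.2 j ^ 2 * (-(6 * β * (x.1 j - x.1 i)) / (1 + 3 * β * (x.1 j - x.1 i) ^ 2) ^ 2) -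
            partialQ j ((pinnedChain ω₂ lam β γ).hamiltonian L) x * (1 / (1 + 3 * β * (x.1 j - x.1 i) ^ 2))) +
          x.2 j * (x.2 i ^ 2 * (-(6 * β * (x.1 j - x.1 i)) / (1 + 3 * β * (x.1 j - x.1 i) ^ 2) ^ 2) +
            partialQ i ((pinnedChain ω₂ lam β γ).hamiltonian L) x * (1 / (1 + 3 * β * (x.1 j - x.1 i) ^ 2))))
        else 0) * (∑ i : Fin L, (pinnedChain ω₂ lam β γ).bondCurrent L i x) ∂((pinnedChain ω₂ lam β γ).gibbsMeasure L T) =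
      ((L : ℝ) - 1) * T ^ 2 := by
  rw [integral_mul_totalCurrent_eq_pattern hω hl hβ hγ hT (contDiff_two_thomsonWitness (L := L) hβ.le) hv2 hXv2 hGv2]
  rw [← integral_blockEnergySum_mul_sq_sub_sq hω hl.le hβ.le γ hT hL]
  refine integral_congr_ae (Filter.Eventually.of_forall fun x => ?_)
  dsimp only
  rw [patternAvg_liouvillian_thomsonWitness (ω₂ := ω₂) (lam := lam) (γ := γ) hβ.le hL x]

/-- **Registered helper `helper_thomsonWitnessPairing`** of stmt-AtomisticToContinuum-11977 (lead c7, Thomson-witness project,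
stubs B/A7): `integral_thomsonWitness_mul_totalCurrent`, fully quantified and notation-free (the witness is spelled with
`let`-abbreviations `r, φ, dφ`; definitionally the same function). [folklore] -/
theorem helper_thomsonWitnessPairing : ∀ (ω₂ lam β γ T : ℝ), 0 < ω₂ → 0 < lam → 0 < β → 0 < γ → 0 < T → ∀ (L : ℕ), 2 ≤ L → MeasureTheory.MemLp (fun x : Literature.MathematicalPhysics.KineticTheory.HeatConduction.PhaseSpace L => ∑ i : Fin L, ∑ j : Fin L, if j.val = i.val + 1 then (let r := x.1 j - x.1 i; let φ := 1 / (1 + 3 * β * r ^ 2); let dφ := -(6 * β * r) / (1 + 3 * β * r ^ 2) ^ 2; x.2 i * (x.2 j ^ 2 * dφ - Literature.MathematicalPhysics.KineticTheory.HeatConduction.partialQ j ((Literature.MathematicalPhysics.KineticTheory.HeatConduction.pinnedChain ω₂ lam β γ).hamiltonian L) x * φ) + x.2 j * (x.2 i ^ 2 * dφ + Literature.MathematicalPhysics.KineticTheory.HeatConduction.partialQ i ((Literature.MathematicalPhysics.KineticTheory.HeatConduction.pinnedChain ω₂ lam β γ).hamiltonian L) x * φ)) else 0) 2 ((Literature.MathematicalPhysics.KineticTheory.HeatConduction.pinnedChain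 ω₂ lam β γ).gibbsMeasure L T) → MeasureTheory.MemLp ((Literature.MathematicalPhysics.KineticTheory.HeatConduction.pinnedChain ω₂ lam β γ).liouvillian L (fun x : Literature.MathematicalPhysics.KineticTheory.HeatConduction.PhaseSpace L => ∑ i : Fin L, ∑ j : Fin L, if j.val = i.val + 1 then (let r := x.1 j - x.1 i; let φ := 1 / (1 + 3 * β * r ^ 2); let dφ := -(6 * β * r) / (1 + 3 * β * r ^ 2) ^ 2; x.2 i * (x.2 j ^ 2 * dφ - Literature.MathematicalPhysics.KineticTheory.HeatConduction.partialQ j ((Literature.MathematicalPhysics.KineticTheory.HeatConduction.pinnedChain ω₂ lam β γ).hamiltonian L) x * φ) + x.2 j * (x.2 i ^ 2 * dφ + Literature.MathematicalPhysics.KineticTheory.HeatConduction.partialQ i ((Literature.MathematicalPhysics.KineticTheory.HeatConduction.pinnedChain ω₂ lam β γ).hamiltonian L) x * φ)) else 0)) 2 ((Literature.MathematicalPhysics.KineticTheory.HeatConduction.pinnedChain ω₂ lam β γ).gibbsMeasure L T) → MeasureTheory.MemLp ((Literature.MathematicalPhysics.KineticTheory.HeatConduction.pinnedChain ω₂ lam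 β γ).generator L T T (fun x : Literature.MathematicalPhysics.KineticTheory.HeatConduction.PhaseSpace L => ∑ i : Fin L, ∑ j : Fin L, if j.val = i.val + 1 then (let r := x.1 j - x.1 i; let φ := 1 / (1 + 3 * β * r ^ 2); let dφ := -(6 * β * r) / (1 + 3 * β * r ^ 2) ^ 2; x.2 i * (x.2 j ^ 2 * dφ - Literature.MathematicalPhysics.KineticTheory.HeatConduction.partialQ j ((Literature.MathematicalPhysics.KineticTheory.HeatConduction.pinnedChain ω₂ lam β γ).hamiltonian L) x * φ) + x.2 j * (x.2 i ^ 2 * dφ + Literature.MathematicalPhysics.KineticTheory.HeatConduction.partialQ i ((Literature.MathematicalPhysics.KineticTheory.HeatConduction.pinnedChain ω₂ lam β γ).hamiltonian L) x * φ)) else 0)) 2 ((Literature.MathematicalPhysics.KineticTheory.HeatConduction.pinnedChain ω₂ lam β γ).gibbsMeasure L T) → MeasureTheory.integral ((Literature.MathematicalPhysics.KineticTheory.HeatConduction.pinnedChain ω₂ lam β γ).gibbsMeasure L T) (fun x => (fun x : Literature.MathematicalPhysics.KineticTheory.HeatConduction.PhaseSpace L => ∑ i : Fin L, ∑ j : Fin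 L, if j.val = i.val + 1 then (let r := x.1 j - x.1 i; let φ := 1 / (1 + 3 * β * r ^ 2); let dφ := -(6 * β * r) / (1 + 3 * β * r ^ 2) ^ 2; x.2 i * (x.2 j ^ 2 * dφ - Literature.MathematicalPhysics.KineticTheory.HeatConduction.partialQ j ((Literature.MathematicalPhysics.KineticTheory.HeatConduction.pinnedChain ω₂ lam β γ).hamiltonian L) x * φ) + x.2 j * (x.2 i ^ 2 * dφ + Literature.MathematicalPhysics.KineticTheory.HeatConduction.partialQ i ((Literature.MathematicalPhysics.KineticTheory.HeatConduction.pinnedChain ω₂ lam β γ).hamiltonian L) x * φ)) else 0) x * ∑ i : Fin L, (Literature.MathematicalPhysics.KineticTheory.HeatConduction.pinnedChain ω₂ lam β γ).bondCurrent L i x) = ((L : ℝ) - 1) * T ^ 2 :=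
  fun _ _ _ γ _ hω hl hβ hγ hT _ hL hv2 hXv2 hGv2 =>
    integral_thomsonWitness_mul_totalCurrent (γ := γ) hω hl hβ hγ hT hL hv2 hXv2 hGv2

end Summit.AtomisticToContinuum.FouriersLaw.Theorems.NoisyFourier.ThomsonWitness.Pairing

end
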